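import Summits.BirchSwinnertonDyer.BirchSwinnertonDyer.Theorems.KimAtThreeDeepLowerOffStratumLevelLoweringCanonicalPeriod
import Summits.BirchSwinnertonDyer.BirchSwinnertonDyer.Theorems.KimAtThreeDeepLowerOffStratumLevelLoweringStabEigenform
import HarnessLib

/-!
# Route `KimAtThreeKolyvagin` (rung W2), crux `DeepLowerAtThreeOffKatoStratum` (item 19679), registered
# stub `stub_nonAdditive`, ROAD (b²): the CANONICAL-PERIOD NORMALISATION for the plus symbol of the
# `ℓ`-STABILISED form `G = ι₁ g − t ι_ℓ g` of a newform `g` (squarefree level, one non-Eisenstein prime)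

Cell `bsd-addord`, seat `bsd-addord-w2-acc2`, gen 5; item `stmt-BirchSwinnertonDyer-19679` (`--supports`, closes
nothing). ROAD (b²) file 3: the comparison form on the 8 107 «one extra unramified prime» rows is
`h = ι₁ G − β ι_q G` with `G = ι₁ g − t ι_ℓ g ∈ S₂(Γ₀(M₀ℓ))` (`g` the optimal-level newform); THEOREM A needs a
normalisation `Ω` of `Ψ = plusSymbol G`, integral on `ℚ` and a unit on one cycle. `G` has a COMPLEX coefficient `t`,
so `…CanonicalPeriod` is re-run in the real structure `{ι₁ g, ι_ℓ g}`: `Ψ(k∞) = Re{∞,k∞}_{ι₁g} − t·Re{∞,k∞}_{ι_ℓ g}`,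
Manin's ONE integral chain at level `M₀ℓ` (`exists_chain`) makes it an integral combination of the plus M-symbols
`u_q = Re m_q(ι₁g) − t Re m_q(ι_ℓ g)` (differences of two path values), whence a maximal path value `Ω`; if all cycle
values were in `𝔪Ω` the reduced symbol would be constant on cusp classes `gcd(den, M₀ℓ)` (squarefree level) and
the Hecke relation of `G` at `r` (`smul_plusSymbol_of_heckeT`) would kill it. Theorems only; no definition, no fact.

* §1 `plusSymbol_stabForm_eq`, `exists_psi_eq_sum`, `norm_psi_le_sup`, `exists_norm_psi_eq_sup`.
* §2 ★ `exists_period_integral_unit_cycle_stab`.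

## References

* V. Vatsal, Duke Math. J. 98 (1999), §1 (1.3) display (5), (1.5)–(1.6), Remark (1.12). [Vatsal1999]
* J. E. Cremona, *Algorithms for modular elliptic curves* (1997), §2.1–§2.4, §2.8. [CremonaAlgorithms1997]
* F. Diamond, J. Shurman (2005), §3.8, §5.7. [DiamondShurman2005]
-/

set_option autoImplicit false
-- the Theorems namespace of a single-conjunct summit repeats the summit name by design (D-0017)
set_option linter.dupNamespace false

noncomputable section

open scoped MatrixGroups ModularForm Classical NNReal

open CongruenceSubgroup WeierstrassCurve Literature.NumberTheory.EllipticCurves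
  Literature.NumberTheory.EllipticCurves.ModularForms ModularGroup
open UpperHalfPlane hiding I

namespace Summit.BirchSwinnertonDyer.BirchSwinnertonDyer.Theorems.KimAtThreeDeepLowerOffStratumLevelLoweringStabCanonicalPeriod

open Summit.BirchSwinnertonDyer.BirchSwinnertonDyer.Theorems.KimAtThreeDeepLowerOffStratumLevelLoweringVatsal
open Summit.BirchSwinnertonDyer.BirchSwinnertonDyer.Theorems.KimAtThreeDeepLowerOffStratumLevelLoweringVatsalStab
open Summit.BirchSwinnertonDyer.BirchSwinnertonDyer.Theorems.KimAtThreeDeepLowerOffStratumLevelLoweringVatsalStabRows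
open Summit.BirchSwinnertonDyer.BirchSwinnertonDyer.Theorems.KimAtThreeDeepLowerOffStratumLevelLoweringCanonicalPeriod
open Summit.BirchSwinnertonDyer.BirchSwinnertonDyer.Theorems.KimAtThreeDeepLowerOffStratumLevelLoweringStabEigenform
  hiding heckeT_stab_of_ne heckeT_stab_self isHeckeEigenform_stab cuspCoeff_stab_prime cuspCoeff_mul_cuspCoeff

/-! ### §1 The plus symbol of `G = ι₁ g − t ι_ℓ g` in the real structure `{ι₁ g, ι_ℓ g}`; bounded denominators -/

section Structure

variable {M₀ ℓ : ℕ} [NeZero M₀] [NeZero ℓ] [NeZero (M₀ * ℓ)] (g : CuspForm (Gamma0 M₀) 2) (t : ℂ)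
  (h1 : M₀ * 1 ∣ M₀ * ℓ) (hℓℓ : M₀ * ℓ ∣ M₀ * ℓ) (ι : PadicAlgCl 3 ≃+* ℂ)

omit [NeZero M₀] [NeZero ℓ] [NeZero (M₀ * ℓ)] in
/-- The old forms `ι_d g` have real coefficients when `g` has. [folklore] -/
theorem cuspCoeff_iota_im_eq_zero (hreal : ∀ n, (cuspCoeff g n).im = 0) {d : ℕ} [NeZero d] (hd : M₀ * d ∣ M₀ * ℓ)
    (n : ℕ) : (cuspCoeff (iota M₀ (M₀ * ℓ) d 2 hd g) n).im = 0 := by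
  rw [cuspCoeff, qExpansion_coeff_iota]
  split_ifs
  · exact hreal _
  · simp

omit [NeZero M₀] in
/-- **`Ψ = plusSymbol G` in the real structure**: for `k ∈ SL₂(ℤ)` with first column `(num x, den x)`,
`plusSymbol G x = Re{∞, k∞}_{ι₁ g} − t·Re{∞, k∞}_{ι_ℓ g}`. [cite: CremonaAlgorithms1997, §2.8] -/
theorem plusSymbol_stabForm_eq (hreal : ∀ n, (cuspCoeff g n).im = 0) {x : ℚ} {k : SL(2, ℤ)} (h0 : k 0 0 = x.num)
    (hk1 : k 1 0 = x.den) :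
    plusSymbol (iota M₀ (M₀ * ℓ) 1 2 h1 g - t • iota M₀ (M₀ * ℓ) ℓ 2 hℓℓ g) x =
      (((inftySymbol (iota M₀ (M₀ * ℓ) 1 2 h1 g) k).re : ℝ) : ℂ) -
        t * (((inftySymbol (iota M₀ (M₀ * ℓ) ℓ 2 hℓℓ g) k).re : ℝ) : ℂ) := by
  have hlin : ∀ r : ℚ, plusSymbol (iota M₀ (M₀ * ℓ) 1 2 h1 g - t • iota M₀ (M₀ * ℓ) ℓ 2 hℓℓ g) r =
      plusSymbol (iota M₀ (M₀ * ℓ) 1 2 h1 g) r - t * plusSymbol (iota M₀ (M₀ * ℓ) ℓ 2 hℓℓ g) r := by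
    intro r
    have hms : ∀ s : ℚ, modularSymbol (iota M₀ (M₀ * ℓ) 1 2 h1 g - t • iota M₀ (M₀ * ℓ) ℓ 2 hℓℓ g) s =
        modularSymbol (iota M₀ (M₀ * ℓ) 1 2 h1 g) s - t * modularSymbol (iota M₀ (M₀ * ℓ) ℓ 2 hℓℓ g) s := by
      intro s
      have h := modularSymbol_add (iota M₀ (M₀ * ℓ) 1 2 h1 g - t • iota M₀ (M₀ * ℓ) ℓ 2 hℓℓ g)
        (t • iota M₀ (M₀ * ℓ) ℓ 2 hℓℓ g) s
      rw [sub_add_cancel, modularSymbol_smul] at h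
      linear_combination (-1 : ℂ) * h
    simp only [plusSymbol, hms]
    ring
  rw [hlin, plusSymbol_eq_re_inftySymbol _ (cuspCoeff_iota_im_eq_zero g hreal h1) h0 hk1,
    plusSymbol_eq_re_inftySymbol _ (cuspCoeff_iota_im_eq_zero g hreal hℓℓ) h0 hk1]

omit [NeZero M₀] in
/-- **Finite generation**: `Re{∞, k∞}_{ι₁g} − t Re{∞, k∞}_{ι_ℓ g} = Σ_q c_q u_q` with `c_q ∈ ℤ` and the plus M-symbols
`u_q = Re m_q(ι₁ g) − t Re m_q(ι_ℓ g)` (ONE chain for both old forms: `exists_chain` is a statement on functionals).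
[cite: CremonaAlgorithms1997, §2.3] -/
theorem exists_psi_eq_sum (k : SL(2, ℤ)) :
    ∃ c : Gamma0Coset (M₀ * ℓ) → ℤ,
      (((inftySymbol (iota M₀ (M₀ * ℓ) 1 2 h1 g) k).re : ℝ) : ℂ) -
          t * (((inftySymbol (iota M₀ (M₀ * ℓ) ℓ 2 hℓℓ g) k).re : ℝ) : ℂ) =
        ∑ q, (c q : ℂ) * (((((msymbol (M₀ * ℓ) q) (iota M₀ (M₀ * ℓ) 1 2 h1 g)).re : ℝ) : ℂ) -
          t * ((((msymbol (M₀ * ℓ) q) (iota M₀ (M₀ * ℓ) ℓ 2 hℓℓ g)).re : ℝ) : ℂ)) := by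
  obtain ⟨c, hcint, hcm, -⟩ := exists_chain (N := M₀ * ℓ) k
  choose m hm using hcint
  refine ⟨m, ?_⟩
  have heval : ∀ φ : CuspForm (Gamma0 (M₀ * ℓ)) 2,
      (((inftySymbol φ k).re : ℝ) : ℂ) = ∑ q, (m q : ℂ) * ((((msymbol (M₀ * ℓ) q) φ).re : ℝ) : ℂ) := by
    intro φ
    have h := LinearMap.congr_fun hcm φ
    rw [inftyFunctional_apply] at h
    have : inftySymbol φ k = ∑ q, (c q : ℂ) * (msymbol (M₀ * ℓ) q) φ := by
      rw [← h, msymbolMap, Fintype.linearCombination_apply, LinearMap.sum_apply]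
      refine Finset.sum_congr rfl fun q _ ↦ ?_
      rw [LinearMap.smul_apply, Rat.smul_def]
    rw [this, Complex.re_sum, Complex.ofReal_sum]
    refine Finset.sum_congr rfl fun q _ ↦ ?_
    rw [hm q, show ((m q : ℚ) : ℂ) = ((m q : ℝ) : ℂ) by push_cast; rfl, Complex.re_ofReal_mul]
    push_cast
    rfl
  rw [heval, heval, Finset.mul_sum, ← Finset.sum_sub_distrib]
  refine Finset.sum_congr rfl fun q _ ↦ ?_
  ring

omit [NeZero M₀] in
/-- **Bounded denominators**: every `Ψ` path value has norm `≤ C := max_q ‖ι⁻¹ u_q‖` (whatever `t`).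
[cite: MazurTateTeitelbaum1986Invent, §I.8] -/
theorem norm_psi_le_sup (k : SL(2, ℤ)) :
    ‖ι.symm ((((inftySymbol (iota M₀ (M₀ * ℓ) 1 2 h1 g) k).re : ℝ) : ℂ) -
        t * (((inftySymbol (iota M₀ (M₀ * ℓ) ℓ 2 hℓℓ g) k).re : ℝ) : ℂ))‖ ≤
      Finset.univ.sup' ⟨((1 : SL(2, ℤ)) : Gamma0Coset (M₀ * ℓ)), Finset.mem_univ _⟩
        (fun q : Gamma0Coset (M₀ * ℓ) ↦ ‖ι.symm ((((((msymbol (M₀ * ℓ) q) (iota M₀ (M₀ * ℓ) 1 2 h1 g)).re : ℝ) : ℂ) -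
          t * ((((msymbol (M₀ * ℓ) q) (iota M₀ (M₀ * ℓ) ℓ 2 hℓℓ g)).re : ℝ) : ℂ)))‖) := by
  set u : Gamma0Coset (M₀ * ℓ) → ℂ := fun q ↦ ((((msymbol (M₀ * ℓ) q) (iota M₀ (M₀ * ℓ) 1 2 h1 g)).re : ℝ) : ℂ) -
    t * ((((msymbol (M₀ * ℓ) q) (iota M₀ (M₀ * ℓ) ℓ 2 hℓℓ g)).re : ℝ) : ℂ) with hu
  set C := Finset.univ.sup' ⟨((1 : SL(2, ℤ)) : Gamma0Coset (M₀ * ℓ)), Finset.mem_univ _⟩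
    (fun q : Gamma0Coset (M₀ * ℓ) ↦ ‖ι.symm (u q)‖) with hC
  have hCq : ∀ q, ‖ι.symm (u q)‖ ≤ C := fun q ↦
    Finset.le_sup' (fun q : Gamma0Coset (M₀ * ℓ) ↦ ‖ι.symm (u q)‖) (Finset.mem_univ q)
  have hC0 : 0 ≤ C := (norm_nonneg _).trans (hCq ((1 : SL(2, ℤ)) : Gamma0Coset (M₀ * ℓ)))
  obtain ⟨c, hc⟩ := exists_psi_eq_sum g t h1 hℓℓ k
  rw [hc, map_sum]
  refine IsUltrametricDist.norm_sum_le_of_forall_le_of_nonneg hC0 fun q _ ↦ ?_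
  rw [map_mul, map_intCast, norm_mul]
  exact mul_le_of_le_one_left (norm_nonneg _) (norm_intCast_le_one _) |>.trans (hCq q)

omit [NeZero M₀] in
/-- **The maximum is attained at a path**: each `u_q` is a difference of two path values of `Ψ`. [folklore] -/
theorem exists_norm_psi_eq_sup :
    ∃ k : SL(2, ℤ), ‖ι.symm ((((inftySymbol (iota M₀ (M₀ * ℓ) 1 2 h1 g) k).re : ℝ) : ℂ) -
        t * (((inftySymbol (iota M₀ (M₀ * ℓ) ℓ 2 hℓℓ g) k).re : ℝ) : ℂ))‖ =
      Finset.univ.sup' ⟨((1 : SL(2, ℤ)) : Gamma0Coset (M₀ * ℓ)), Finset.mem_univ _⟩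
        (fun q : Gamma0Coset (M₀ * ℓ) ↦ ‖ι.symm ((((((msymbol (M₀ * ℓ) q) (iota M₀ (M₀ * ℓ) 1 2 h1 g)).re : ℝ) : ℂ) -
          t * ((((msymbol (M₀ * ℓ) q) (iota M₀ (M₀ * ℓ) ℓ 2 hℓℓ g)).re : ℝ) : ℂ)))‖) := by
  set A := iota M₀ (M₀ * ℓ) 1 2 h1 g with hA
  set B := iota M₀ (M₀ * ℓ) ℓ 2 hℓℓ g with hB
  set Ψk : SL(2, ℤ) → ℂ := fun k ↦ (((inftySymbol A k).re : ℝ) : ℂ) - t * (((inftySymbol B k).re : ℝ) : ℂ) with hΨk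
  set u : Gamma0Coset (M₀ * ℓ) → ℂ := fun q ↦ ((((msymbol (M₀ * ℓ) q) A).re : ℝ) : ℂ) -
    t * ((((msymbol (M₀ * ℓ) q) B).re : ℝ) : ℂ) with hu
  set C := Finset.univ.sup' ⟨((1 : SL(2, ℤ)) : Gamma0Coset (M₀ * ℓ)), Finset.mem_univ _⟩
    (fun q : Gamma0Coset (M₀ * ℓ) ↦ ‖ι.symm (u q)‖) with hC
  change ∃ k, ‖ι.symm (Ψk k)‖ = C
  obtain ⟨q₀, -, hq₀⟩ := Finset.exists_mem_eq_sup' ⟨((1 : SL(2, ℤ)) : Gamma0Coset (M₀ * ℓ)), Finset.mem_univ _⟩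
    (fun q : Gamma0Coset (M₀ * ℓ) ↦ ‖ι.symm (u q)‖)
  set k₀ : SL(2, ℤ) := Quotient.out q₀ with hk₀
  have hmq : ∀ φ : CuspForm (Gamma0 (M₀ * ℓ)) 2, (msymbol (M₀ * ℓ) q₀) φ = inftySymbol φ k₀⁻¹ - inftySymbol φ (k₀⁻¹ * S) := by
    intro φ
    have : q₀ = (k₀ : Gamma0Coset (M₀ * ℓ)) := (Quotient.out_eq q₀).symm
    rw [this, msymbol_mk, msymbolFunctional_apply, msymbolSL]
  have huq : u q₀ = Ψk k₀⁻¹ - Ψk (k₀⁻¹ * S) := by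
    simp only [hu, hΨk, hmq, Complex.sub_re, Complex.ofReal_sub]
    ring
  have hA' := norm_psi_le_sup g t h1 hℓℓ ι k₀⁻¹
  have hB' := norm_psi_le_sup g t h1 hℓℓ ι (k₀⁻¹ * S)
  rw [← hC] at hA' hB'
  change ‖ι.symm (Ψk k₀⁻¹)‖ ≤ C at hA'
  change ‖ι.symm (Ψk (k₀⁻¹ * S))‖ ≤ C at hB'
  by_contra hne
  push Not at hne
  have hA'' : ‖ι.symm (Ψk k₀⁻¹)‖ < C := lt_of_le_of_ne hA' (hne _)
  have hB'' : ‖ι.symm (Ψk (k₀⁻¹ * S))‖ < C := lt_of_le_of_ne hB' (hne _)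
  have hlt : ‖ι.symm (u q₀)‖ < C := by
    rw [huq, map_sub, sub_eq_add_neg]
    refine lt_of_le_of_lt (PadicAlgCl.isNonarchimedean 3 _ _) (max_lt hA'' ?_)
    rwa [norm_neg]
  rw [← hC] at hq₀
  exact absurd hq₀.symm (ne_of_lt hlt)

end Structure

/-! ### §2 The normalisation `Ω` for `Ψ = plusSymbol G`: integral on `ℚ`, a unit on one cycle -/

section Period

variable {M₀ ℓ : ℕ} [NeZero M₀] [NeZero ℓ] [NeZero (M₀ * ℓ)] (g : CuspForm (Gamma0 M₀) 2) (t : ℂ)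
  (h1 : M₀ * 1 ∣ M₀ * ℓ) (hℓℓ : M₀ * ℓ ∣ M₀ * ℓ)

omit [NeZero M₀] in
/-- `plusSymbol G x = Re{∞, x}_{ι₁ g} − t·Re{∞, x}_{ι_ℓ g}` for every `x ∈ ℚ` (real coefficients of the two old forms).
[cite: CremonaAlgorithms1997, §2.8] -/
theorem plusSymbol_stabForm_eq_re (hreal : ∀ n, (cuspCoeff g n).im = 0) (x : ℚ) :
    plusSymbol (iota M₀ (M₀ * ℓ) 1 2 h1 g - t • iota M₀ (M₀ * ℓ) ℓ 2 hℓℓ g) x =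
      (((modularSymbol (iota M₀ (M₀ * ℓ) 1 2 h1 g) x).re : ℝ) : ℂ) -
        t * (((modularSymbol (iota M₀ (M₀ * ℓ) ℓ 2 hℓℓ g) x).re : ℝ) : ℂ) := by
  obtain ⟨k, h0, hk1⟩ := exists_sl_apply_eq_num_den x
  rw [plusSymbol_stabForm_eq g t h1 hℓℓ hreal h0 hk1, inftySymbol_eq_modularSymbol _ h0 hk1,
    inftySymbol_eq_modularSymbol _ h0 hk1]

omit [NeZero M₀] in
/-- **Same cusp class ⟹ `Ψ` differs by a CYCLE value** (squarefree level `M₀ℓ`; Manin relation for both old forms).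
[cite: DiamondShurman2005, §3.8] [cite: CremonaAlgorithms1997, §2.2] -/
theorem exists_plusSymbol_stabForm_eq_sub (hM : Squarefree (M₀ * ℓ)) (hreal : ∀ n, (cuspCoeff g n).im = 0)
    {x y : ℚ} (hxy : Nat.gcd x.den (M₀ * ℓ) = Nat.gcd y.den (M₀ * ℓ)) :
    ∃ γ : Gamma0 (M₀ * ℓ),
      plusSymbol (iota M₀ (M₀ * ℓ) 1 2 h1 g - t • iota M₀ (M₀ * ℓ) ℓ 2 hℓℓ g) y =
        plusSymbol (iota M₀ (M₀ * ℓ) 1 2 h1 g - t • iota M₀ (M₀ * ℓ) ℓ 2 hℓℓ g) x -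
          ((((cuspSymbol (iota M₀ (M₀ * ℓ) 1 2 h1 g) γ).re : ℝ) : ℂ) -
            t * (((cuspSymbol (iota M₀ (M₀ * ℓ) ℓ 2 hℓℓ g) γ).re : ℝ) : ℂ)) := by
  obtain ⟨kx, hx0, hx1⟩ := exists_sl_apply_eq_num_den x
  obtain ⟨ky, hy0, hy1⟩ := exists_sl_apply_eq_num_den y
  have hdiv : cuspDivisor (M₀ * ℓ) kx = cuspDivisor (M₀ * ℓ) ky := by
    rw [cuspDivisor, cuspDivisor, hx1, hy1, Int.gcd_natCast_natCast, Int.gcd_natCast_natCast, hxy]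
  obtain ⟨γ, hγ, hp⟩ := (cuspOrbitOf_eq_iff (M₀ * ℓ) kx ky).mp (cuspOrbitOf_eq_of_cuspDivisor_eq hM hdiv)
  refine ⟨⟨γ, hγ⟩, ?_⟩
  have hmaninA := inftySymbol_mul_of_mem (iota M₀ (M₀ * ℓ) 1 2 h1 g) hγ ky
  have hmaninB := inftySymbol_mul_of_mem (iota M₀ (M₀ * ℓ) ℓ 2 hℓℓ g) hγ ky
  have hfix : ∀ φ : CuspForm (Gamma0 (M₀ * ℓ)) 2, inftySymbol φ (γ * ky) = inftySymbol φ kx := by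
    intro φ
    rw [show γ * ky = kx * (kx⁻¹ * γ * ky) by group]
    exact inftySymbol_mul_of_apply_one_zero_eq_zero φ kx _ hp
  rw [plusSymbol_stabForm_eq g t h1 hℓℓ hreal hy0 hy1, plusSymbol_stabForm_eq g t h1 hℓℓ hreal hx0 hx1, ← hfix, ← hfix,
    hmaninA, hmaninB, Complex.add_re, Complex.add_re, Complex.ofReal_add, Complex.ofReal_add]
  ring

variable {g}

/-- ★ **THE CANONICAL-PERIOD NORMALISATION for `Ψ = plusSymbol (ι₁ g − t ι_ℓ g)`** (`g` a newform of level `M₀`,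
`ℓ ∤ M₀` prime, `M₀ℓ` SQUAREFREE, `Ψ ≢ 0`, and ONE prime `r ∤ M₀ℓ` with `a_r(g) − r − 1` a `3`-adic unit): there is
`Ω ∈ ℂ` with `Ψ(x)/Ω` integral for every `x ∈ ℚ` and `Ψ(γ₀∞)/Ω` a UNIT for some `γ₀ ∈ Γ₀(M₀ℓ)`, `γ₀∞ ≠ ∞`.
Mechanism as in `…CanonicalPeriod.exists_period_integral_unit_cycle`, run in the real structure `{ι₁ g, ι_ℓ g}`.
[cite: Vatsal1999, §1 (1.3) display (5), (1.5)–(1.6), Remark (1.12)] [cite: CremonaAlgorithms1997, §2.3 and §2.8]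
[cite: DiamondShurman2005, §3.8] -/
theorem exists_period_integral_unit_cycle_stab (ι : PadicAlgCl 3 ≃+* ℂ) (hM : Squarefree (M₀ * ℓ))
    (hg : IsNewform0 g) (hℓ : ℓ.Prime)
    (hne : ∃ x : ℚ, plusSymbol (iota M₀ (M₀ * ℓ) 1 2 h1 g - t • iota M₀ (M₀ * ℓ) ℓ 2 hℓℓ g) x ≠ 0)
    {r : ℕ} (hr : r.Prime) (hrM : ¬ r ∣ M₀ * ℓ) (hE : Valued.v (ι.symm (cuspCoeff g r - (r + 1))) = 1) :
    ∃ Ω : ℂ, (∀ x : ℚ, Valued.v (ι.symm (plusSymbol (iota M₀ (M₀ * ℓ) 1 2 h1 g - t • iota M₀ (M₀ * ℓ) ℓ 2 hℓℓ g) x / Ω)) ≤ 1) ∧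
      ∃ γ₀ : Gamma0 (M₀ * ℓ), (γ₀ : SL(2, ℤ)) 1 0 ≠ 0 ∧
        Valued.v (ι.symm (plusSymbol (iota M₀ (M₀ * ℓ) 1 2 h1 g - t • iota M₀ (M₀ * ℓ) ℓ 2 hℓℓ g)
          ((((γ₀ : SL(2, ℤ)) 0 0 : ℤ) : ℚ) / (((γ₀ : SL(2, ℤ)) 1 0 : ℤ) : ℚ)) / Ω)) = 1 := by
  classical
  haveI := charP_residueField
  haveI : NeZero r := ⟨hr.ne_zero⟩
  set res := IsLocalRing.residue (Valued.integer (PadicAlgCl 3)) with hres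
  set A := iota M₀ (M₀ * ℓ) 1 2 h1 g with hA
  set B := iota M₀ (M₀ * ℓ) ℓ 2 hℓℓ g with hB
  set G := A - t • B with hG
  have hreal : ∀ n, (cuspCoeff g n).im = 0 := hg.cuspCoeff_im_eq_zero
  have hrℓ : r ≠ ℓ := by rintro rfl; exact hrM (dvd_mul_left r M₀)
  have hrM₀ : ¬ r ∣ M₀ := fun h ↦ hrM (h.mul_right ℓ)
  -- the path values `Ψk k` and the bound `C`, attained at `kS`
  set Ψk : SL(2, ℤ) → ℂ := fun k ↦ (((inftySymbol A k).re : ℝ) : ℂ) - t * (((inftySymbol B k).re : ℝ) : ℂ) with hΨk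
  set C := Finset.univ.sup' ⟨((1 : SL(2, ℤ)) : Gamma0Coset (M₀ * ℓ)), Finset.mem_univ _⟩
    (fun q : Gamma0Coset (M₀ * ℓ) ↦ ‖ι.symm (((((msymbol (M₀ * ℓ) q) A).re : ℝ) : ℂ) -
      t * ((((msymbol (M₀ * ℓ) q) B).re : ℝ) : ℂ))‖) with hC
  have hle : ∀ k : SL(2, ℤ), ‖ι.symm (Ψk k)‖ ≤ C := fun k ↦ norm_psi_le_sup g t h1 hℓℓ ι k
  obtain ⟨kS, hkS⟩ := exists_norm_psi_eq_sup g t h1 hℓℓ ι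
  rw [← hC] at hkS
  change ‖ι.symm (Ψk kS)‖ = C at hkS
  -- `Ψk k = Ψ(k∞)` for `k∞ ≠ ∞`, and `Ψk k = 0` for `k∞ = ∞`
  have hΨk_of_ne : ∀ k : SL(2, ℤ), k 1 0 ≠ 0 → Ψk k = plusSymbol G (((k 0 0 : ℤ) : ℚ) / ((k 1 0 : ℤ) : ℚ)) := by
    intro k hk
    simp only [hΨk, inftySymbol, if_neg hk, hG, hA, hB]
    rw [plusSymbol_stabForm_eq_re g t h1 hℓℓ hreal]
  have hΨk_of_eq : ∀ k : SL(2, ℤ), k 1 0 = 0 → Ψk k = 0 := by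
    intro k hk
    simp only [hΨk, inftySymbol, if_pos hk, Complex.zero_re, Complex.ofReal_zero, mul_zero, sub_zero]
  have hΨx : ∀ x : ℚ, ∃ k : SL(2, ℤ), k 1 0 ≠ 0 ∧ plusSymbol G x = Ψk k := by
    intro x
    obtain ⟨k, h0, hk1⟩ := exists_sl_apply_eq_num_den x
    refine ⟨k, by rw [hk1]; exact_mod_cast x.den_ne_zero, ?_⟩
    rw [hG, plusSymbol_stabForm_eq g t h1 hℓℓ hreal h0 hk1]
  -- `C > 0` from `Ψ ≢ 0`
  have hC0 : 0 < C := by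
    obtain ⟨x₀, hx₀⟩ := hne
    obtain ⟨k₀, -, hk₀⟩ := hΨx x₀
    have h1' : ι.symm (Ψk k₀) ≠ 0 := by
      rw [map_ne_zero_iff _ ι.symm.injective, ← hk₀]; exact hx₀
    exact (norm_pos_iff.mpr h1').trans_le (hle k₀)
  set Ω : ℂ := Ψk kS with hΩdef
  have hΩC : ‖ι.symm Ω‖ = C := hkS
  have hΩ0 : ι.symm Ω ≠ 0 := by rw [← norm_pos_iff, hΩC]; exact hC0
  have hkS10 : kS 1 0 ≠ 0 := by
    intro h0
    apply hΩ0
    rw [hΩdef, hΨk_of_eq kS h0, map_zero]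
  -- (i) integrality on `ℚ`
  have hnorm : ∀ z : ℂ, ‖ι.symm (z / Ω)‖ = ‖ι.symm z‖ / C := by
    intro z; rw [map_div₀, norm_div, hΩC]
  have hint : ∀ x : ℚ, Valued.v (ι.symm (plusSymbol G x / Ω)) ≤ 1 := by
    intro x
    obtain ⟨k, -, hk⟩ := hΨx x
    rw [valuation_le_one_iff, hnorm, hk, div_le_one hC0]
    exact hle k
  refine ⟨Ω, hint, ?_⟩
  -- (ii) a unit on some cycle
  by_contra H
  push Not at H
  have hcyc : ∀ γ : Gamma0 (M₀ * ℓ), ‖ι.symm (Ψk γ / Ω)‖ < 1 := by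
    intro γ
    by_cases h0 : (γ : SL(2, ℤ)) 1 0 = 0
    · rw [hΨk_of_eq _ h0, zero_div, map_zero, norm_zero]
      exact zero_lt_one
    · have hγ := H γ h0
      rw [hΨk_of_ne _ h0]
      have h1' := hint ((((γ : SL(2, ℤ)) 0 0 : ℤ) : ℚ) / (((γ : SL(2, ℤ)) 1 0 : ℤ) : ℚ))
      rw [valuation_le_one_iff] at h1'
      rw [Ne, valuation_eq_one_iff] at hγ
      exact lt_of_le_of_ne h1' hγ
  -- membership proofs and the reduced symbol `ψ`
  have mX : ∀ x : ℚ, ι.symm (plusSymbol G x / Ω) ∈ Valued.integer (PadicAlgCl 3) := fun x ↦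
    mem_integer_iff_norm_le_one.mpr (valuation_le_one_iff.mp (hint x))
  let ψ : ℚ → IsLocalRing.ResidueField (Valued.integer (PadicAlgCl 3)) := fun x ↦
    res ⟨ι.symm (plusSymbol G x / Ω), mX x⟩
  -- (E) `ψ` is constant on cusp classes `gcd(den, M₀ℓ)`
  have hE' : ∀ x y : ℚ, Nat.gcd x.den (M₀ * ℓ) = Nat.gcd y.den (M₀ * ℓ) → ψ y = ψ x := by
    intro x y hxy
    obtain ⟨γ, hγ⟩ := exists_plusSymbol_stabForm_eq_sub g t h1 hℓℓ hM hreal hxy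
    have hγ' : plusSymbol G y = plusSymbol G x - Ψk γ := by
      rw [hG, hγ, hΨk, cuspSymbol_eq_inftySymbol, cuspSymbol_eq_inftySymbol]
    have mγ : ι.symm (Ψk γ / Ω) ∈ Valued.integer (PadicAlgCl 3) := mem_integer_iff_norm_le_one.mpr (hcyc γ).le
    have hO : (⟨ι.symm (plusSymbol G y / Ω), mX y⟩ : Valued.integer (PadicAlgCl 3)) =
        ⟨ι.symm (plusSymbol G x / Ω), mX x⟩ - ⟨ι.symm (Ψk γ / Ω), mγ⟩ := by
      apply Subtype.ext
      push_cast
      rw [← map_sub, hγ', sub_div]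
    show res _ = res _
    rw [hO, map_sub, residue_mk_eq_zero_of_norm_lt_one mγ (hcyc γ), sub_zero]
  -- (F) the Hecke relation of `G` at `r` kills `ψ`
  have ma : ι.symm (cuspCoeff g r) ∈ Valued.integer (PadicAlgCl 3) :=
    mem_integer_iff_norm_le_one.mpr (valuation_le_one_iff.mp (valuation_cuspCoeff_le_one_of_isNewform0 hg ι r))
  have hunit : res ⟨ι.symm (cuspCoeff g r), ma⟩ -
      ((r : IsLocalRing.ResidueField (Valued.integer (PadicAlgCl 3))) + 1) ≠ 0 := by
    have mE : ι.symm (cuspCoeff g r - (r + 1)) ∈ Valued.integer (PadicAlgCl 3) :=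
      mem_integer_iff_norm_le_one.mpr (valuation_eq_one_iff.mp hE).le
    have heq : (⟨ι.symm (cuspCoeff g r - (r + 1)), mE⟩ : Valued.integer (PadicAlgCl 3)) =
        ⟨ι.symm (cuspCoeff g r), ma⟩ - ((r : Valued.integer (PadicAlgCl 3)) + 1) := by
      apply Subtype.ext
      push_cast
      rw [map_sub, map_add, map_natCast, map_one]
    have h : res ⟨ι.symm (cuspCoeff g r - (r + 1)), mE⟩ =
        res ⟨ι.symm (cuspCoeff g r), ma⟩ - ((r : IsLocalRing.ResidueField (Valued.integer (PadicAlgCl 3))) + 1) := by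
      rw [heq, map_sub res, map_add res, map_natCast res, map_one res]
    rw [← h, Ne, IsLocalRing.residue_eq_zero_iff, IsLocalRing.mem_maximalIdeal, mem_nonunits_iff, not_not,
      Valuation.Integers.isUnit_iff_valuation_eq_one (Valuation.integer.integers _)]
    exact hE
  have hT : heckeT (Gamma0 (M₀ * ℓ)) 2 r G = cuspCoeff g r • G := by
    rw [hG, hA, hB]
    exact heckeT_stab_of_ne hg t h1 hℓℓ hℓ hr hrℓ
  have hF : ∀ x : ℚ, ψ x = 0 := by
    intro x
    have hH := smul_plusSymbol_of_heckeT r hr hrM hT x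
    have hO : (⟨ι.symm (cuspCoeff g r), ma⟩ : Valued.integer (PadicAlgCl 3)) * ⟨ι.symm (plusSymbol G x / Ω), mX x⟩ =
        (∑ j : Fin r, ⟨ι.symm (plusSymbol G ((x + j) / r) / Ω), mX ((x + j) / r)⟩) +
          ⟨ι.symm (plusSymbol G (r * x) / Ω), mX (r * x)⟩ := by
      apply Subtype.ext
      push_cast
      rw [← map_mul, ← map_sum, ← map_add]
      congr 1
      rw [mul_div_assoc', hH, add_div, Finset.sum_div]
    have h := congrArg res hO
    rw [map_mul, map_add, map_sum] at h
    have hj : ∀ j : Fin r, res ⟨ι.symm (plusSymbol G ((x + j) / r) / Ω), mX ((x + j) / r)⟩ = ψ x := by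
      intro j
      refine hE' x _ ?_
      rw [gcd_den_div_prime hr hrM, show (x + (j : ℚ)) = x + ((j : ℕ) : ℤ) by push_cast; rfl,
        Rat.add_intCast_den]
    have hrx : res ⟨ι.symm (plusSymbol G (r * x) / Ω), mX (r * x)⟩ = ψ x :=
      hE' x _ (gcd_den_prime_mul hr hrM x).symm
    simp only [hj, hrx, Finset.sum_const, Finset.card_univ, Fintype.card_fin, nsmul_eq_mul] at h
    have hψ : (res ⟨ι.symm (cuspCoeff g r), ma⟩ -
        ((r : IsLocalRing.ResidueField (Valued.integer (PadicAlgCl 3))) + 1)) * ψ x = 0 := by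
      rw [sub_mul, add_mul, one_mul, h, sub_self]
    exact (mul_eq_zero.mp hψ).resolve_left hunit
  -- (G) but `ψ(xS) = 1`
  set xS : ℚ := ((kS 0 0 : ℤ) : ℚ) / ((kS 1 0 : ℤ) : ℚ) with hxS
  have hΩx : plusSymbol G xS = Ω := by rw [hΩdef, hΨk_of_ne kS hkS10]
  have h1' : ψ xS = 1 := by
    have hO : (⟨ι.symm (plusSymbol G xS / Ω), mX xS⟩ : Valued.integer (PadicAlgCl 3)) = 1 := by
      apply Subtype.ext
      push_cast
      rw [hΩx, div_self (fun h ↦ hΩ0 (by rw [h, map_zero])), map_one]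
    show res _ = 1
    rw [hO, map_one]
  exact one_ne_zero (h1' ▸ hF xS)

end Period

end Summit.BirchSwinnertonDyer.BirchSwinnertonDyer.Theorems.KimAtThreeDeepLowerOffStratumLevelLoweringStabCanonicalPeriod

end
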